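import Literature.Analysis.FluidPDE.OnsagerBDSVGluedVelocity
import Literature.Analysis.FluidPDE.EulerTorusUniqueness
import Literature.Analysis.FunctionSpaces.ContDiffHolderLeibniz
import HarnessLib

/-!
# The BDSV gluing stage: Prop. 4.4 — the energy bound (2.22) of the glued velocity

Buckmaster–De Lellis–Székelyhidi–Vicol, *Onsager's conjecture for admissible weak solutions*,
CPAM 72 (2019) = arXiv:1701.08678, §4.5, Prop. 4.4: "`|∫|v̄_q|² - ∫|v_ℓ|²| ≲ δ_{q+1}ℓ^α`" (2.22),
proved there by writing `|v̄_q|² - |v_ℓ|² = χᵢ(|vᵢ|² - |v_ℓ|²) + (1-χᵢ)(|vᵢ₊₁|² - |v_ℓ|²) - χᵢ(1-χᵢ)|vᵢ - vᵢ₊₁|²`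
on `[tᵢ, tᵢ₊₁]`, controlling `∫|vᵢ|² - ∫|v_ℓ|²` from `vᵢ(tᵢ) = v_ℓ(tᵢ)`, the conservation of the
energy of the exact solution `vᵢ` and the energy balance `d/dt ∫|v_ℓ|² = -2∫R̊_ℓ : ∇v_ℓ` of the
Euler–Reynolds triple over a time `≤ τ_q`, and the last term by (3.12).

Contents (all proved):

* `Torus.IsEulerReynoldsOn.hasDerivWithinAt_energy` — the **energy balance** of a smooth
  Euler–Reynolds solution on `T^d`: `d/dt ∫|v|² = -2 ∫ ∑ⱼ ⟪R^{(j)}, ∂ⱼv⟫` (one-sided, on `[a,b]`);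
* `Torus.IsEulerReynoldsOn.abs_energyRate_le` — `|2∫∑ⱼ⟪R^{(j)},∂ⱼv⟫| ≤ 2 d · sup|R| · sup|∇v|`;
* `BDSV.IsGlueFamily.abs_energy_v_sub_le` — `|∫|vᵢ(t)|² - ∫|v_ℓ(t)|²| ≤ 6 B_R B_v τ` on `Sᵢ`;
* `BDSV.IsGlueFamily.abs_energy_gluedVel_sub_le` — **(2.22)**:
  `|∫|v̄(t)|² - ∫|v_ℓ(t)|²| ≤ (6 Cin₀² + 4 C₃²) δ_{q+1} ℓ^α` on `[0,T]`.

## References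

* T. Buckmaster, C. De Lellis, L. Székelyhidi Jr., V. Vicol, *Onsager's conjecture for admissible
  weak solutions*, Comm. Pure Appl. Math. 72 (2019) 229–274 = arXiv:1701.08678, §4.5 (Prop. 4.4),
  §2.5 (2.22).
-/

noncomputable section

open MeasureTheory Set Filter Topology Function
open scoped NNReal ENNReal ContDiff InnerProductSpace

namespace Literature.Analysis.FluidPDE

/-! ## The energy balance of an Euler–Reynolds solution -/

namespace Torus

open FunctionSpaces FunctionSpaces.Torus

variable {d : Type*} [Fintype d] [DecidableEq d]
variable {a b : ℝ} {v : ℝ → UnitAddTorus d → EuclideanSpace ℝ d} {p : ℝ → UnitAddTorus d → ℝ}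
  {R : ℝ → UnitAddTorus d → d → EuclideanSpace ℝ d}

/-- **Energy balance of the Euler–Reynolds system**: for a smooth solution on `[a,b] × T^d`
(`a < b`), `t ↦ ∫|v(t)|²` has one-sided derivative `-2∫ ∑ⱼ ⟪R^{(j)}(t), ∂ⱼv(t)⟫` within `[a,b]`
(`d/dt ∫|v|² = 2∫⟪∂ₜv, v⟫ = 2∫⟪div R - (v·∇)v - ∇p, v⟫`, the transport and pressure terms
integrating to zero for divergence-free `v`, and `∫⟪div R, v⟫ = -∫∑ⱼ⟪R^{(j)}, ∂ⱼv⟫`); for `R = 0`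
this is the conservation of energy of smooth Euler solutions (BDSV §4.5, proof of Prop. 4.4).
[cite: BuckmasterEtAl2018, Prop. 4.4 (proof)] -/
theorem IsEulerReynoldsOn.hasDerivWithinAt_energy (h : IsEulerReynoldsOn (Icc a b) v p R) (hab : a < b)
    {t : ℝ} (ht : t ∈ Icc a b) :
    HasDerivWithinAt (fun s => ∫ x, ‖v s x‖ ^ 2)
      (-2 * ∫ x, ∑ j, ⟪R t x j, FunctionSpaces.Torus.partialDeriv j (v t) x⟫_ℝ) (Icc a b) t := by
  classical
  have hU : UniqueDiffOn ℝ (Icc a b) := uniqueDiffOn_Icc hab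
  have hv := h.smooth_velocity
  have hE : HasDerivWithinAt (fun s => ∫ x, ⟪v s x, v s x⟫_ℝ)
      (∫ x, FunctionSpaces.Torus.timeDerivWithin (Icc a b) (fun s y => ⟪v s y, v s y⟫_ℝ) t x) (Icc a b) t :=
    (hv.inner hv).hasDerivWithinAt_integral (convex_Icc a b) ht
  have hfun : (fun s => ∫ x, ‖v s x‖ ^ 2) = fun s => ∫ x, ⟪v s x, v s x⟫_ℝ := by
    funext s
    exact integral_congr_ae (Eventually.of_forall fun x => (real_inner_self_eq_norm_sq (v s x)).symm)
  rw [hfun]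
  convert hE using 1
  have hvt : FunctionSpaces.Torus.IsSmooth (v t) := hv.isSmooth_slice ht
  have hpt : FunctionSpaces.Torus.IsSmooth (p t) := h.smooth_pressure.isSmooth_slice ht
  have hRt : FunctionSpaces.Torus.IsSmooth (R t) := h.smooth_stress.isSmooth_slice ht
  have hpw : ∀ x, FunctionSpaces.Torus.timeDerivWithin (Icc a b) (fun s y => ⟪v s y, v s y⟫_ℝ) t x =
      2 * ⟪FunctionSpaces.Torus.timeDerivWithin (Icc a b) v t x, v t x⟫_ℝ := by
    intro x
    rw [hv.timeDerivWithin_inner hv hU ht x, real_inner_comm (v t x)]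
    ring
  have hmom : ∀ x, FunctionSpaces.Torus.timeDerivWithin (Icc a b) v t x =
      tensorDivergence (R t) x - FunctionSpaces.Torus.convect (v t) (v t) x -
        FunctionSpaces.Torus.gradient (p t) x := by
    intro x
    rw [← h.momentum t ht x]
    abel
  simp_rw [hpw, hmom]
  have i1 : Integrable (fun x => ⟪tensorDivergence (R t) x, v t x⟫_ℝ) volume :=
    (hRt.tensorDivergence.inner hvt).integrable
  have i2 : Integrable (fun x => ⟪FunctionSpaces.Torus.convect (v t) (v t) x, v t x⟫_ℝ) volume :=
    ((hvt.convect hvt).inner hvt).integrable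
  have i3 : Integrable (fun x => ⟪FunctionSpaces.Torus.gradient (p t) x, v t x⟫_ℝ) volume :=
    (hpt.gradient.inner hvt).integrable
  have i12 : Integrable (fun x => ⟪tensorDivergence (R t) x, v t x⟫_ℝ -
      ⟪FunctionSpaces.Torus.convect (v t) (v t) x, v t x⟫_ℝ) volume := i1.sub i2
  simp_rw [inner_sub_left]
  rw [integral_const_mul, integral_sub i12 i3, integral_sub i1 i2,
    integral_inner_convect_eq_zero hvt hvt (h.divFree t ht),
    FunctionSpaces.Torus.integral_inner_gradient_eq_zero_of_isDivFree hvt hpt (h.divFree t ht),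
    integral_inner_tensorDivergence hRt hvt]
  ring

omit [DecidableEq d] in
/-- The size of the energy rate: if `|R(t,x)ⱼ| ≤ B_R` and `|∂ⱼv(t,x)| ≤ B_v` for all `x, j`, then
`|2∫∑ⱼ⟪R^{(j)}, ∂ⱼv⟫| ≤ 2 d B_R B_v` (the torus has volume one). [folklore] -/
theorem abs_energyRate_le [DecidableEq d] {t : ℝ} {BR Bv : ℝ} (hBR : 0 ≤ BR)
    (hR : ∀ x j, ‖R t x j‖ ≤ BR) (hDv : ∀ x j, ‖FunctionSpaces.Torus.partialDeriv j (v t) x‖ ≤ Bv) :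
    |(-2 : ℝ) * ∫ x, ∑ j, ⟪R t x j, FunctionSpaces.Torus.partialDeriv j (v t) x⟫_ℝ| ≤
      2 * Fintype.card d * BR * Bv := by
  have hpt : ∀ x, |∑ j, ⟪R t x j, FunctionSpaces.Torus.partialDeriv j (v t) x⟫_ℝ| ≤ Fintype.card d * (BR * Bv) := by
    intro x
    refine (Finset.abs_sum_le_sum_abs _ _).trans ?_
    calc ∑ j, |⟪R t x j, FunctionSpaces.Torus.partialDeriv j (v t) x⟫_ℝ| ≤ ∑ _j : d, BR * Bv :=
          Finset.sum_le_sum fun j _ => (abs_real_inner_le_norm _ _).trans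
            (mul_le_mul (hR x j) (hDv x j) (norm_nonneg _) hBR)
      _ = Fintype.card d * (BR * Bv) := by
          rw [Finset.sum_const, Finset.card_univ, nsmul_eq_mul]
  have hint : |∫ x, ∑ j, ⟪R t x j, FunctionSpaces.Torus.partialDeriv j (v t) x⟫_ℝ| ≤ Fintype.card d * (BR * Bv) := by
    refine (abs_integral_le_integral_abs).trans ?_
    calc ∫ x, |∑ j, ⟪R t x j, FunctionSpaces.Torus.partialDeriv j (v t) x⟫_ℝ|
        ≤ ∫ _x : UnitAddTorus d, (Fintype.card d * (BR * Bv) : ℝ) :=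
          integral_mono_of_nonneg (Eventually.of_forall fun x => abs_nonneg _) (integrable_const _)
            (Eventually.of_forall hpt)
      _ = Fintype.card d * (BR * Bv) := by simp
  rw [abs_mul, abs_neg, abs_two]
  calc 2 * |∫ x, ∑ j, ⟪R t x j, FunctionSpaces.Torus.partialDeriv j (v t) x⟫_ℝ|
      ≤ 2 * (Fintype.card d * (BR * Bv)) := by gcongr
    _ = 2 * Fintype.card d * BR * Bv := by ring

end Torus

namespace BDSV

open FunctionSpaces FunctionSpaces.Torus

/-- The flat three-torus `T³ = (ℝ/ℤ)³`, local notation. -/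
local notation "𝕋³" => UnitAddTorus (Fin 3)

/-- Euclidean `ℝ³`, local notation. -/
local notation "ℝ³" => EuclideanSpace ℝ (Fin 3)

/-! ## Pointwise tools -/

section Pointwise

/-- `|θu + (1-θ)w|² = θ|u|² + (1-θ)|w|² - θ(1-θ)|u - w|²` (BDSV §4.5:
"`|v̄_q|² - |v_ℓ|² = χᵢ(|vᵢ|² - |v_ℓ|²) + (1-χᵢ)(|vᵢ₊₁|² - |v_ℓ|²) - χᵢ(1-χᵢ)|vᵢ - vᵢ₊₁|²`").
[cite: BuckmasterEtAl2018, Prop. 4.4 (proof)] -/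
theorem norm_sq_convex_comb {E : Type*} [NormedAddCommGroup E] [InnerProductSpace ℝ E] (u w : E) (θ : ℝ) :
    ‖θ • u + (1 - θ) • w‖ ^ 2 = θ * ‖u‖ ^ 2 + (1 - θ) * ‖w‖ ^ 2 - θ * (1 - θ) * ‖u - w‖ ^ 2 := by
  simp only [← real_inner_self_eq_norm_sq, inner_add_left, inner_add_right, inner_sub_left,
    inner_sub_right, real_inner_smul_left, real_inner_smul_right]
  rw [real_inner_comm w u]
  ring

/-- From `‖f‖_{C^{k,r}} ≤ B` to the pointwise bound `|f(x)| ≤ max B 0`. [folklore] -/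
theorem norm_le_max_of_eContDiffHolderNorm_le {F : Type*} [NormedAddCommGroup F] [NormedSpace ℝ F]
    {f : 𝕋³ → F} {k : ℕ} {r : ℝ≥0} {B : ℝ}
    (h : FunctionSpaces.Torus.eContDiffHolderNorm k r f ≤ ENNReal.ofReal B) (x : 𝕋³) : ‖f x‖ ≤ max B 0 := by
  have h1 := (Torus.enorm_le_eContDiffHolderNorm k r f x).trans h
  rw [← ofReal_norm, show ENNReal.ofReal B = ENNReal.ofReal (max B 0) from by
    rcases le_total B 0 with hB | hB
    · rw [max_eq_right hB, ENNReal.ofReal_of_nonpos hB, ENNReal.ofReal_zero]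
    · rw [max_eq_left hB]] at h1
  exact (ENNReal.ofReal_le_ofReal_iff (le_max_right _ _)).1 h1

/-- From `‖g‖_{C^{1,r}} ≤ B` to the pointwise bound `|∂ⱼg(x)| ≤ max B 0` on the first partial
derivatives (`‖∂ⱼg‖_{0,r} ≤ ‖g‖_{1,r}`). [folklore] -/
theorem norm_partialDeriv_le_max_of_eContDiffHolderNorm_le {F : Type*} [NormedAddCommGroup F] [NormedSpace ℝ F]
    {g : 𝕋³ → F} (hg : FunctionSpaces.Torus.IsSmooth g) {r : ℝ≥0} {B : ℝ}
    (h : FunctionSpaces.Torus.eContDiffHolderNorm 1 r g ≤ ENNReal.ofReal B) (j : Fin 3) (x : 𝕋³) :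
    ‖FunctionSpaces.Torus.partialDeriv j g x‖ ≤ max B 0 :=
  norm_le_max_of_eContDiffHolderNorm_le
    ((Torus.eContDiffHolderNorm_partialDeriv_le (k := 0) (hg.isContDiff (mod_cast le_top)) j r).trans h) x

variable {β α a b : ℝ}

/-- `ℓ ≤ 1` (`ℓ ≤ λ_q⁻¹ ≤ 1`) for `a, b ≥ 1`, `β, α ≥ 0`. [cite: BuckmasterEtAl2018, §2.4 (2.11)] -/
theorem mollScale_le_one (ha : 1 ≤ a) (hb : 1 ≤ b) (hβ : 0 ≤ β) (hα : 0 ≤ α) (q : ℕ) :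
    mollScale β α a b q ≤ 1 :=
  (mollScale_le_freq_inv ha hb hβ hα q).trans (inv_le_one_of_one_le₀ (one_le_freq ha q))

end Pointwise

/-! ## Prop. 4.4 -/

section Energy

variable {β α a b T C₃ : ℝ} {q n Nb : ℕ} {vℓ : ℝ → 𝕋³ → ℝ³} {pℓ : ℝ → 𝕋³ → ℝ}
  {Rℓ : ℝ → 𝕋³ → Fin 3 → ℝ³} {v : ℕ → ℝ → 𝕋³ → ℝ³} {p : ℕ → ℝ → 𝕋³ → ℝ} {Cin : ℕ → ℝ}

/-- **The energy of an exact solution stays close to that of the mollified triple**: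
`|∫|vᵢ(t)|² - ∫|v_ℓ(t)|²| ≤ 6 B_R B_v τ` on the life span `Sᵢ` (`i ≤ n`), where `B_R` bounds
`|R̊_ℓ|` and `B_v` bounds `|∇v_ℓ|` on `[0,T] × T³`: both energies are differentiable on `Sᵢ`, agree
at `tᵢ` (`vᵢ(tᵢ) = v_ℓ(tᵢ)`), `d/dt∫|vᵢ|² = 0` and `|d/dt∫|v_ℓ|²| = |2∫R̊_ℓ : ∇v_ℓ| ≤ 6 B_R B_v`, and
`|t - tᵢ| ≤ τ` on `Sᵢ` (BDSV §4.5). [cite: BuckmasterEtAl2018, Prop. 4.4 (proof)] -/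
theorem IsGlueFamily.abs_energy_v_sub_le {τ : ℝ} (h : IsGlueFamily T τ n vℓ pℓ Rℓ v p) {i : ℕ}
    (hi : i ≤ n) {BR Bv : ℝ} (hBR : 0 ≤ BR)
    (hR : ∀ s ∈ Icc 0 T, ∀ x j, ‖Rℓ s x j‖ ≤ BR)
    (hDv : ∀ s ∈ Icc 0 T, ∀ x j, ‖FunctionSpaces.Torus.partialDeriv j (vℓ s) x‖ ≤ Bv)
    {t : ℝ} (ht : t ∈ glueInterval T τ i) :
    |(∫ x, ‖v i t x‖ ^ 2) - ∫ x, ‖vℓ t x‖ ^ 2| ≤ 6 * BR * Bv * τ := by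
  have hτ := h.hτ
  have hiT := h.anchor_le hi
  set a' := max ((i : ℝ) * τ - τ) 0 with ha'
  set b' := min ((i : ℝ) * τ + τ) T with hb'
  have hS : glueInterval T τ i = Icc a' b' := glueInterval_eq_Icc T τ i
  have hi0 : 0 ≤ (i : ℝ) * τ := by positivity
  have hab : a' < b' := by
    simp only [ha', hb', max_lt_iff, lt_min_iff]
    refine ⟨⟨by linarith, by linarith⟩, by linarith, h.hT⟩
  have hsub : Icc a' b' ⊆ Icc 0 T := by rw [← hS]; exact glueInterval_subset_Icc T τ i
  have ht' : t ∈ Icc a' b' := by rwa [hS] at ht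
  have hanchor : (i : ℝ) * τ ∈ Icc a' b' := by
    rw [← hS]; exact anchor_mem_glueInterval hτ.le hiT
  -- the two Euler–Reynolds structures on `[a', b']`
  have hexI : Torus.IsEulerReynoldsOn (Icc a' b') (v i) (p i) (fun _ _ _ => 0) := by
    have := h.exact i hiT
    unfold IsExactEulerOn at this
    rwa [hS] at this
  have hℓI : Torus.IsEulerReynoldsOn (Icc a' b') vℓ pℓ Rℓ := h.er.restrict hsub (uniqueDiffOn_Icc hab)
  -- the difference of the energies and its derivative
  set F : ℝ → ℝ := fun s => (∫ x, ‖v i s x‖ ^ 2) - ∫ x, ‖vℓ s x‖ ^ 2 with hF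
  set F' : ℝ → ℝ := fun s =>
    (-2 * ∫ x, ∑ j, ⟪(0 : ℝ³), FunctionSpaces.Torus.partialDeriv j (v i s) x⟫_ℝ) -
      (-2 * ∫ x, ∑ j, ⟪Rℓ s x j, FunctionSpaces.Torus.partialDeriv j (vℓ s) x⟫_ℝ) with hF'
  have hderiv : ∀ s ∈ Icc a' b', HasDerivWithinAt F (F' s) (Icc a' b') s := fun s hs =>
    (hexI.hasDerivWithinAt_energy hab hs).sub (hℓI.hasDerivWithinAt_energy hab hs)
  have hbound : ∀ s ∈ Icc a' b', ‖F' s‖ ≤ 6 * BR * Bv := by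
    intro s hs
    have h0 : (-2 * ∫ x, ∑ j, ⟪(0 : ℝ³), FunctionSpaces.Torus.partialDeriv j (v i s) x⟫_ℝ) = 0 := by
      simp
    have h1 := Torus.abs_energyRate_le (v := vℓ) (R := Rℓ) (t := s) hBR (hR s (hsub hs)) (hDv s (hsub hs))
    rw [Fintype.card_fin] at h1
    simp only [hF', h0, zero_sub, norm_neg, Real.norm_eq_abs]
    calc _ ≤ _ := h1
      _ = 6 * BR * Bv := by push_cast; ring
  have key := Convex.norm_image_sub_le_of_norm_hasDerivWithin_le hderiv hbound (convex_Icc a' b') hanchor ht'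
  have hF0 : F ((i : ℝ) * τ) = 0 := by
    simp only [hF, h.anchor i hiT, sub_self]
  rw [hF0, sub_zero, Real.norm_eq_abs, Real.norm_eq_abs] at key
  have hdist : |t - (i : ℝ) * τ| ≤ τ := by
    rw [abs_sub_le_iff]
    constructor <;> linarith [ht.1.1, ht.1.2]
  have hC : 0 ≤ 6 * BR * Bv := by
    have := hbound t ht'
    exact (norm_nonneg _).trans this
  calc |F t| ≤ 6 * BR * Bv * |t - (i : ℝ) * τ| := key
    _ ≤ 6 * BR * Bv * τ := mul_le_mul_of_nonneg_left hdist hC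

/-- **(2.22)** (Prop. 4.4): for the glued triple of a `BDSV.IsGlueFamily` with the §3 stability
bounds (constant `C₃`) and the inductive bounds (2.13) on `v_ℓ`, (2.14) on `R̊_ℓ` (constants `Cin`),
`|∫|v̄(t)|² - ∫|v_ℓ(t)|²| ≤ (6 Cin₀² + 4 C₃²) δ_{q+1} ℓ^α` for every `t ∈ [0,T]`
(`|v̄|² = θ|vᵢ|² + (1-θ)|vᵢ'|² - θ(1-θ)|vᵢ - vᵢ'|²`; the first two energies are within
`6 Cin₀² δ_{q+1}ℓ^αℓ^{2α}` of `∫|v_ℓ|²` by `abs_energy_v_sub_le` and `τ_qδ_q^{1/2}λ_q = ℓ^{2α}`, and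
`|vᵢ - vᵢ'| ≤ 2|C₃|τ_qδ_{q+1}ℓ^{-1+α} ≤ 2|C₃|δ_{q+1}^{1/2}ℓ^α` by (3.12) and (4.6)).
[cite: BuckmasterEtAl2018, Prop. 4.4 (2.22)] -/
theorem IsGlueFamily.abs_energy_gluedVel_sub_le (h : IsGlueFamily T (glueScale β α a b q) n vℓ pℓ Rℓ v p)
    (hS : ∀ i : ℕ, i ≤ n → StabilityBounds β α a b T C₃ q Nb i vℓ pℓ (v i) (p i)) (ha : 1 ≤ a)
    (hb : 1 ≤ b) (hβ : 0 ≤ β) (hα : 0 ≤ α)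
    (h213 : ∀ N : ℕ, HolderSupLE T vℓ (N + 1) 0
      (Cin N * (Real.sqrt (amp β a b q) * freq a b q * mollScale β α a b q ^ (-(N : ℝ)))))
    (h214 : ∀ N : ℕ, HolderSupLE T Rℓ N (Real.toNNReal α)
      (Cin N * (amp β a b (q + 1) * mollScale β α a b q ^ (-(N : ℝ) + α))))
    {t : ℝ} (htT : t ∈ Icc 0 T) :
    |(∫ x, ‖gluedVel (glueScale β α a b q) n v t x‖ ^ 2) - ∫ x, ‖vℓ t x‖ ^ 2| ≤
      (6 * Cin 0 ^ 2 + 4 * C₃ ^ 2) * (amp β a b (q + 1) * mollScale β α a b q ^ α) := by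
  set τ := glueScale β α a b q with hτdef
  set ℓ := mollScale β α a b q with hℓdef
  set δ := amp β a b (q + 1) with hδdef
  set A := Real.sqrt (amp β a b q) * freq a b q with hAdef
  have hτ : 0 < τ := h.hτ
  have hℓ : 0 < ℓ := mollScale_pos ha q
  have hℓ1 : ℓ ≤ 1 := mollScale_le_one ha hb hβ hα q
  have hδ : 0 < δ := amp_pos ha (q + 1)
  have hA : 0 < A := mul_pos (Real.sqrt_pos.2 (amp_pos ha q)) (freq_pos ha q)
  have hℓα : 0 < ℓ ^ α := Real.rpow_pos_of_pos hℓ α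
  -- the sup bounds on `R̊_ℓ` and `∇v_ℓ`
  set BR := |Cin 0| * (δ * ℓ ^ α) with hBR
  set Bv := |Cin 0| * A with hBv
  have hBR0 : 0 ≤ BR := by positivity
  have hBv0 : 0 ≤ Bv := by positivity
  have hR : ∀ s ∈ Icc 0 T, ∀ x j, ‖Rℓ s x j‖ ≤ BR := by
    intro s hs x j
    have h0 := h214 0 s hs
    simp only [Nat.cast_zero, neg_zero, zero_add] at h0
    have hx := norm_le_max_of_eContDiffHolderNorm_le h0 x
    refine (norm_le_pi_norm (Rℓ s x) j).trans (hx.trans (max_le ?_ hBR0))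
    exact mul_le_mul_of_nonneg_right (le_abs_self _) (by positivity)
  have hDv : ∀ s ∈ Icc 0 T, ∀ x j, ‖FunctionSpaces.Torus.partialDeriv j (vℓ s) x‖ ≤ Bv := by
    intro s hs x j
    have h0 := h213 0 s hs
    simp only [Nat.cast_zero, neg_zero, Real.rpow_zero, mul_one, zero_add] at h0
    have hx := norm_partialDeriv_le_max_of_eContDiffHolderNorm_le (h.isSmooth_vℓ hs) h0 j x
    refine hx.trans (max_le ?_ hBv0)
    exact mul_le_mul_of_nonneg_right (le_abs_self _) hA.le
  -- `6 B_R B_v τ = 6 Cin₀² δ ℓ^α ℓ^{2α} ≤ 6 Cin₀² δ ℓ^α`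
  have hK : 6 * BR * Bv * τ ≤ 6 * Cin 0 ^ 2 * (δ * ℓ ^ α) := by
    have hsq : |Cin 0| * |Cin 0| = Cin 0 ^ 2 := by rw [← sq, sq_abs]
    have e : 6 * BR * Bv * τ = 6 * Cin 0 ^ 2 * (δ * ℓ ^ α) * (τ * A) := by
      rw [← hsq]
      simp only [hBR, hBv]
      ring
    rw [e, hAdef, hτdef, glueScale_mul_sqrt_amp_mul_freq ha q]
    refine mul_le_of_le_one_right (by positivity) ?_
    exact Real.rpow_le_one hℓ.le hℓ1 (by linarith)
  -- the decomposition of `v̄(t)`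
  obtain ⟨i, i', θ, hi, hi', hθ, hti, hti', hdec⟩ := h.exists_convex_decomp htT
  have hu : FunctionSpaces.Torus.IsSmooth (v i t) := h.isSmooth_v hi hti
  have hw : FunctionSpaces.Torus.IsSmooth (v i' t) := h.isSmooth_v hi' hti'
  have hvℓt : FunctionSpaces.Torus.IsSmooth (vℓ t) := h.isSmooth_vℓ htT
  -- energies
  set Eu := ∫ x, ‖v i t x‖ ^ 2 with hEu
  set Ew := ∫ x, ‖v i' t x‖ ^ 2 with hEw
  set Eℓ := ∫ x, ‖vℓ t x‖ ^ 2 with hEℓ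
  set D := ∫ x, ‖v i t x - v i' t x‖ ^ 2 with hD
  have hEbar : (∫ x, ‖gluedVel τ n v t x‖ ^ 2) = θ * Eu + (1 - θ) * Ew - θ * (1 - θ) * D := by
    have hpt : ∀ x, ‖gluedVel τ n v t x‖ ^ 2 =
        θ * ‖v i t x‖ ^ 2 + (1 - θ) * ‖v i' t x‖ ^ 2 - θ * (1 - θ) * ‖v i t x - v i' t x‖ ^ 2 := by
      intro x; rw [hdec x, norm_sq_convex_comb]
    simp_rw [hpt]
    have i1 : Integrable (fun x => θ * ‖v i t x‖ ^ 2) volume := hu.norm_sq.integrable.const_mul θ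
    have i2 : Integrable (fun x => (1 - θ) * ‖v i' t x‖ ^ 2) volume := hw.norm_sq.integrable.const_mul _
    have i3 : Integrable (fun x => θ * (1 - θ) * ‖v i t x - v i' t x‖ ^ 2) volume :=
      (hu.sub hw).norm_sq.integrable.const_mul _
    have i12 : Integrable (fun x => θ * ‖v i t x‖ ^ 2 + (1 - θ) * ‖v i' t x‖ ^ 2) volume := i1.add i2
    rw [integral_sub i12 i3, integral_add i1 i2, integral_const_mul, integral_const_mul,
      integral_const_mul]
  -- the two energy differences
  have hEuℓ : |Eu - Eℓ| ≤ 6 * Cin 0 ^ 2 * (δ * ℓ ^ α) :=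
    (h.abs_energy_v_sub_le hi hBR0 hR hDv hti).trans hK
  have hEwℓ : |Ew - Eℓ| ≤ 6 * Cin 0 ^ 2 * (δ * ℓ ^ α) :=
    (h.abs_energy_v_sub_le hi' hBR0 hR hDv hti').trans hK
  -- the interaction term: `|vᵢ - vᵢ'| ≤ 2|C₃| δ^{1/2} ℓ^α` pointwise
  have hX0 : 0 ≤ τ * δ * ℓ ^ (-1 + α) := by positivity
  have hpoint : ∀ x, ‖v i t x - v i' t x‖ ≤ 2 * |C₃| * (Real.sqrt δ * ℓ ^ α) := by
    intro x
    have h46 : τ * δ * ℓ ^ (-1 + α) ≤ Real.sqrt δ * ℓ ^ α :=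
      glueScale_mul_amp_succ_mul_rpow_le_sqrt ha hb hβ hα q
    have hb1 : ∀ {k : ℕ} (hk : k ≤ n) (htk : t ∈ glueInterval T τ k),
        ‖v k t x - vℓ t x‖ ≤ |C₃| * (Real.sqrt δ * ℓ ^ α) := by
      intro k hk htk
      have hvs := (hS k hk).velocity_sub 0 (Nat.zero_le _) t htk
      simp only [Nat.cast_zero, neg_zero, zero_sub] at hvs
      have hx := norm_le_max_of_eContDiffHolderNorm_le hvs x
      refine hx.trans (max_le ?_ (by positivity))
      calc C₃ * (τ * δ * ℓ ^ (-1 + α)) ≤ |C₃| * (τ * δ * ℓ ^ (-1 + α)) :=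
            mul_le_mul_of_nonneg_right (le_abs_self _) hX0
        _ ≤ |C₃| * (Real.sqrt δ * ℓ ^ α) := mul_le_mul_of_nonneg_left h46 (abs_nonneg _)
    calc ‖v i t x - v i' t x‖ = ‖(v i t x - vℓ t x) - (v i' t x - vℓ t x)‖ := by congr 1; abel
      _ ≤ ‖v i t x - vℓ t x‖ + ‖v i' t x - vℓ t x‖ := norm_sub_le _ _
      _ ≤ |C₃| * (Real.sqrt δ * ℓ ^ α) + |C₃| * (Real.sqrt δ * ℓ ^ α) := add_le_add (hb1 hi hti) (hb1 hi' hti')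
      _ = 2 * |C₃| * (Real.sqrt δ * ℓ ^ α) := by ring
  have hDle : D ≤ 4 * C₃ ^ 2 * (δ * ℓ ^ α) := by
    have hsq : ∀ x, ‖v i t x - v i' t x‖ ^ 2 ≤ (2 * |C₃| * (Real.sqrt δ * ℓ ^ α)) ^ 2 := fun x =>
      pow_le_pow_left₀ (norm_nonneg _) (hpoint x) 2
    have hℓ2α : (ℓ ^ α) ^ 2 ≤ ℓ ^ α := by
      rw [sq]
      exact mul_le_of_le_one_left hℓα.le (Real.rpow_le_one hℓ.le hℓ1 hα)
    calc D ≤ ∫ _x : 𝕋³, (2 * |C₃| * (Real.sqrt δ * ℓ ^ α)) ^ 2 :=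
          integral_mono_of_nonneg (Eventually.of_forall fun x => by positivity) (integrable_const _)
            (Eventually.of_forall hsq)
      _ = (2 * |C₃| * (Real.sqrt δ * ℓ ^ α)) ^ 2 := by simp
      _ = 4 * C₃ ^ 2 * (δ * (ℓ ^ α) ^ 2) := by
          rw [mul_pow, mul_pow, mul_pow, sq_abs, Real.sq_sqrt hδ.le]; ring
      _ ≤ 4 * C₃ ^ 2 * (δ * ℓ ^ α) := by gcongr
  have hD0 : 0 ≤ D := integral_nonneg fun x => by positivity
  have hθ1 : 0 ≤ 1 - θ := sub_nonneg.2 hθ.2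
  have hθθ : θ * (1 - θ) ≤ 1 := by nlinarith [hθ.1, hθ.2]
  -- assemble
  have hrw : (∫ x, ‖gluedVel τ n v t x‖ ^ 2) - Eℓ =
      θ * (Eu - Eℓ) + (1 - θ) * (Ew - Eℓ) - θ * (1 - θ) * D := by rw [hEbar]; ring
  rw [hrw, abs_le]
  obtain ⟨e1l, e1u⟩ := abs_le.1 hEuℓ
  obtain ⟨e2l, e2u⟩ := abs_le.1 hEwℓ
  have e1l' : θ * (-(6 * Cin 0 ^ 2 * (δ * ℓ ^ α))) ≤ θ * (Eu - Eℓ) := mul_le_mul_of_nonneg_left e1l hθ.1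
  have e1u' : θ * (Eu - Eℓ) ≤ θ * (6 * Cin 0 ^ 2 * (δ * ℓ ^ α)) := mul_le_mul_of_nonneg_left e1u hθ.1
  have e2l' : (1 - θ) * (-(6 * Cin 0 ^ 2 * (δ * ℓ ^ α))) ≤ (1 - θ) * (Ew - Eℓ) := mul_le_mul_of_nonneg_left e2l hθ1
  have e2u' : (1 - θ) * (Ew - Eℓ) ≤ (1 - θ) * (6 * Cin 0 ^ 2 * (δ * ℓ ^ α)) := mul_le_mul_of_nonneg_left e2u hθ1
  have e3l : 0 ≤ θ * (1 - θ) * D := mul_nonneg (mul_nonneg hθ.1 hθ1) hD0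
  have e3u : θ * (1 - θ) * D ≤ 4 * C₃ ^ 2 * (δ * ℓ ^ α) :=
    ((mul_le_mul_of_nonneg_right hθθ hD0).trans_eq (one_mul D)).trans hDle
  have hK0 : 0 ≤ 4 * C₃ ^ 2 * (δ * ℓ ^ α) := by positivity
  constructor <;> linarith [e1l', e1u', e2l', e2u', e3l, e3u, hK0]

end Energy

end BDSV

end Literature.Analysis.FluidPDE
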